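/-
Copyright (c) 2026 the pub-hodgecm-mathlib formalisation cell (harness21).  Prover seat hodgecm-mathlib-K2Liu-p10 (g7) (S8 hand), Track B ∕ K2-LIT,
h413 = `stmt-HodgeConjecture-24833`, R90-TF section S8 «ContSpec-n½», the (M) «middle residue» road, (w6) «THE DICTIONARY ITSELF» (S8 dealer R90-CS-plan (g4)
S8-R291; census `K2/K2Liu-p10/g7/CENSUS-w6-GlobalDictionaryData.K2Liu-p10-g7.md` 354210d4787f6e64, line 4), part (w6-b): THE RESIDUE MAP `Res` BUNDLED AS A LINEAR MAP
ON A SPACE OF SECTIONS AND ITS FINITE-ADELIC EQUIVARIANCE FOR THE `z₀ = 3∕2` ACTION — S–M glue over ★ LIN p864683, ★ (T_f) FILE B p864527, ★ FILE A (C133-p02).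
THEOREMS ONLY (no `def`, no instance, no notation, no `sorry`).
-/
import Summits.HodgeConjecture.HodgeConjecture.Theorems.R90S8ResidueClassLinearU3            -- ★ p864683 LIN `res_class_finset_sum` (brings ★ p864527 FILE B `rightRegular_apply_eq_sum_of_flatReexpansion`)
import Summits.HodgeConjecture.HodgeConjecture.Theorems.R90S8ResGMidAtomFlatReexpansionU3    -- ★ FILE A `flatSectionU_mul_finAdelicToAdelic_eq_sum`, `exists_finset_range_heightCocycle`, `borelHeight_mul_finAdelicToAdelic_of_mem_integralLevel`
import Literature.NumberTheory.Automorphic.SmoothRepresentation                              -- ★ `Representation.smoothPart`, `isSmoothVector_of_le`, `mem_stabilizerSubgroup`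
import HarnessLib

/-!
# S8 (M) road, (w6-b): the middle-pole residue `Res` as a LINEAR MAP `V →ₗ L²` on a space of sections carrying ESTATE T's data, and `R(ι_f g)(Res φ) = Res(g·φ)` for the
# `z₀ = 3∕2` action `(g·φ)(x) = φ(x ι_f g)·(H(x ι_f g)∕H(x))^{3∕2}` [MoeglinWaldspurger1995 II.1.5, IV.1.11, V.3.13]

Track B ∕ K2-LIT, crux h413 = `stmt-HodgeConjecture-24833`, route of record `HCCMUnconditional`; cell `hodgecm-mathlib`, R90-TF programme, section S8
«ContSpec-n½», the (M) «middle residue» road of socket B ED. 7 :299, RES-INT lines 1–2 and line 7's `(R, hR)` binders (consumers ★ p865340 `dictionary_D2_of_localIntertwiner`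
∕ ★ `dictionary_D2_of_tensorClause` (p865433): `(R : V →ₗ X) (hR : ∀ g w, R (ρ g w) = σ g (R w))`).  Lane `--supports stmt-HodgeConjecture-24833 --as helper` (count-neutral).
CLOSES NO SOCKET.

THE STEP (census (w6) line 4).  The tree holds `Res` RELATIONALLY: «`f` is the residue class of the section `φ`» is the conjunction of D1's clauses — a continuation `Ec` of
`z ↦ E(φ_z)` off a finite real pole set `Sp ⊂ (1, 2]`, the pole function `Fp` analytic at `3∕2` with `Fp = (z − 3∕2)·Ec` near `3∕2`, and `f =ᵐ x ↦ Fp((out x)⁻¹)(3∕2)` — and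
★ LIN (`res_class_finset_sum`) says the relation is LINEAR (in particular single-valued), ★ FILE B (`rightRegular_apply_eq_sum_of_flatReexpansion`) says
`R(g) f = Σᵢ cᵢ^{3∕2} fᵢ` along any finite flat re-expansion `flat(φ, z)(x g) = Σᵢ cᵢ^z flat(ψᵢ, z)(x)`, and ★ FILE A (`flatSectionU_mul_finAdelicToAdelic_eq_sum`) re-expands every
finite-adelic translate along the height cocycle `c_g = H(· ι_f g)∕H` into the clopen pieces `ψ_r = 𝟙[c_g = r]·φ(· ι_f g)`.  HYPOTHESIS-FIRST on a `ℂ`-submodule `V` of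
level-free `(χ₁, χ₂)`-pair sections of the `φ_ξ`-block (`hVχ`), continuous (`hVc`), CARRYING ESTATE T's data as FAMILIES `(Ec, Sp, Fp, Rf)` over `V` with the six clauses
(`hSp hol hEc hF hFE hae` — the exports at `K`-finite sections, ★ modulo ports), this file BUNDLES: §2 `Rf (Σ aᵢ φᵢ) = Σ aᵢ Rf φᵢ`, hence `∃ R : V →ₗ[ℂ] L², R = Rf`; §3 for
`g ∈ G(𝔸_f)` and `φ, φ′ ∈ V` with `φ′ = g·φ` POINTWISE (`φ′(x) = φ(x ι_f g)·c_g(x)^{3∕2}`) and the pieces of `φ` in `V` (`hVpiece`): `R(ι_f g)(Rf φ) = Rf φ′` (FILE A ⇒ FILE B's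
`hdec`; `φ′ = Σ_r r^{3∕2} ψ_r` pointwise (§1) ⇒ LIN); §4 the package `∃ R : V →ₗ[ℂ] L², R = Rf ∧ R(ι_f g)(R φ) = R (g·φ)`, and its reading for any `Representation` `ρ` of
`G(𝔸_f)` on `V` whose FORMULA is the `z₀ = 3∕2` action (`hρ` — the SEC-DICT Defs leaf discharges it by `rfl`): `R(ι_f g) ∘ R = R ∘ ρ(g)` = the `hR` binder of ★
`dictionary_D2_of_localIntertwiner` before the frame `G_v → G(𝔸_f)` is composed in.
* §1 `sum_cpow_smul_piece_apply` — `(Σ_{r ∈ s} r^w • ψ_r)(x) = φ(x ι_f g)·c_g(x)^w` (only the piece `r = c_g(x)` is alive).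
* §2 **`resClass_finset_sum`**, **`exists_linearMap_resClass`**.
* §3 **`rightRegular_resClass_eq_of_heightTranslate`**.
* §4 **`exists_linearMap_resClass_equivariant`**, **`rightRegular_resClass_eq_rep`**, **`exists_linearMap_resClass_equivariant_rep`**.
* §5 **`resClass_mem_smoothPart`** — `Res φ` is a SMOOTH vector of `R ∘ ι_f` (fixed by the τ-level of `φ`: FILE B at `g ∈ U₀`, cocycle `≡ 1` on `G(𝒪̂)_f`).
* §6 **`exists_linearMap_resClass_frame`** — THE `(R, hR)` BINDERS OF ★ `dictionary_D2_of_localIntertwiner` along any frame `fr : G_v →* G(𝔸_f)`: `R : V →ₗ[ℂ] (L²)^∞` with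
  `R = Rf` and `R ((ρ ∘ fr) g w) = ((L²)^∞ ∘ fr) g (R w)` (the W11 ambient ★ p865275 at `fr := inclPlace v ∘ (localPiEquiv v)⁻¹ ∘ cmDatumLocalCongr`).
HONEST LABEL: pays NO analytic letter — the exports `(Ec, Sp, Fp, Rf, clauses)` on `V`, the closure of `V` under pieces and under the action, and the action-as-`Representation`
(SEC-DICT) stay binders; HC_CM is proved only modulo the 7 printed citations (2 remaining named inputs: hLiu418 = `stmt-HodgeConjecture-24832`, h413 =
`stmt-HodgeConjecture-24833`) until rung 0 closes; (M) :299 stays `sorry`; REL ≠ ★ ≠ BUILT; count-neutral.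

## References
* [MoeglinWaldspurger1995] C. Mœglin, J.-L. Waldspurger, *Spectral Decomposition and Eisenstein Series* (1995), I.2.17, II.1.5–II.1.7, IV.1.9–IV.1.11, V.3.13.
* [Langlands1976] R. P. Langlands, *On the Functional Equations Satisfied by Eisenstein Series*, LNM 544 (1976), §6–§7.
* [Garrett2018] P. Garrett, *Modern Analysis of Automorphic Forms by Example* (2018), §2.2 (height cocycle).
-/

set_option autoImplicit false
set_option linter.dupNamespace false  -- the mandated namespace `…HodgeConjecture.HodgeConjecture.R90.S8` repeats the summit's segment

noncomputable section

open MeasureTheory Measure Set Filter Topology NumberField ContRepresentation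
open Literature.NumberTheory Literature.NumberTheory.Automorphic Literature.NumberTheory.Automorphic.UnitaryGroup Literature.NumberTheory.GaloisRepresentations AdelicGroupData
open Literature.NumberTheory.Automorphic.Arthur2013.Leaves.TECR Literature.NumberTheory.Rogawski1990
open Summit.HodgeConjecture.HodgeConjecture.Cruxes.H413.K2E1BorelEisensteinU
open Summit.HodgeConjecture.HodgeConjecture.Cruxes.H413.K2E1CharacterEisensteinU3PairDefs
open Summit.HodgeConjecture.HodgeConjecture.Cruxes.H413.K2E1ChiSectionSpaceU3PairDefs
open scoped ENNReal NNReal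

namespace Summit.HodgeConjecture.HodgeConjecture.R90.S8

variable (L : Type) [Field L] [NumberField L] [IsCMField L]

/-! ## §1 The pieces of a finite-adelic translate sum back to the `z₀`-translate -/

/-- **`(Σ_{r ∈ s} r^w • ψ_r)(x) = φ(x ι_f g) · c_g(x)^w`** for the pieces `ψ_r = 𝟙[c_g = r]·φ(· ι_f g)` of ★ FILE A and any finset `s ∋ c_g(x)` (`c_g = H(· ι_f g)∕H` the height
cocycle): only the piece `r = c_g(x)` is alive at `x`.  At `w = 3∕2` the right-hand side is the `z₀ = 3∕2` action `(g·φ)(x)`. [cite: MoeglinWaldspurger1995, II.1.5] [cite: Garrett2018, §2.2] -/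
theorem sum_cpow_smul_piece_apply (g : ↥(finAdelic (↥(maximalRealSubfield L)) L (IsCMField.complexConj L) 3 ((StdForm.antidiagonal 3).over L))) {s : Finset ℝ≥0} (hs : ∀ x : (quasiSplit (↥(maximalRealSubfield L)) L (IsCMField.complexConj L) 3).Adelic, borelHeight (x * finAdelicToAdelic (↥(maximalRealSubfield L)) L (IsCMField.complexConj L) 3 ((StdForm.antidiagonal 3).over L) g) / borelHeight x ∈ s)
    (φ : (quasiSplit (↥(maximalRealSubfield L)) L (IsCMField.complexConj L) 3).Adelic → ℂ) (w : ℂ) (x : (quasiSplit (↥(maximalRealSubfield L)) L (IsCMField.complexConj L) 3).Adelic) :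
    (∑ r ∈ s, (((r : ℝ) : ℂ) ^ w) • ({x : (quasiSplit (↥(maximalRealSubfield L)) L (IsCMField.complexConj L) 3).Adelic | borelHeight (x * finAdelicToAdelic (↥(maximalRealSubfield L)) L (IsCMField.complexConj L) 3 ((StdForm.antidiagonal 3).over L) g) / borelHeight x = r}.indicator fun y => φ (y * finAdelicToAdelic (↥(maximalRealSubfield L)) L (IsCMField.complexConj L) 3 ((StdForm.antidiagonal 3).over L) g))) x =
      φ (x * finAdelicToAdelic (↥(maximalRealSubfield L)) L (IsCMField.complexConj L) 3 ((StdForm.antidiagonal 3).over L) g) * (((borelHeight (x * finAdelicToAdelic (↥(maximalRealSubfield L)) L (IsCMField.complexConj L) 3 ((StdForm.antidiagonal 3).over L) g) / borelHeight x : ℝ≥0) : ℝ) : ℂ) ^ w := by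
  rw [Finset.sum_apply, Finset.sum_eq_single_of_mem (borelHeight (x * finAdelicToAdelic (↥(maximalRealSubfield L)) L (IsCMField.complexConj L) 3 ((StdForm.antidiagonal 3).over L) g) / borelHeight x) (hs x) (fun r _ hne => by
    rw [Pi.smul_apply, Set.indicator_of_notMem (fun h => hne (Set.mem_setOf_eq ▸ h).symm), smul_zero])]
  have hmem : x ∈ {y : (quasiSplit (↥(maximalRealSubfield L)) L (IsCMField.complexConj L) 3).Adelic | borelHeight (y * finAdelicToAdelic (↥(maximalRealSubfield L)) L (IsCMField.complexConj L) 3 ((StdForm.antidiagonal 3).over L) g) / borelHeight y = borelHeight (x * finAdelicToAdelic (↥(maximalRealSubfield L)) L (IsCMField.complexConj L) 3 ((StdForm.antidiagonal 3).over L) g) / borelHeight x} := by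
    rw [Set.mem_setOf_eq]
  rw [Pi.smul_apply, Set.indicator_of_mem hmem, smul_eq_mul, mul_comm]

/-! ## §2 `Res` is linear on a space of sections carrying ESTATE T's data -/

section Main

variable (μ : Measure (quasiSplit (↥(maximalRealSubfield L)) L (IsCMField.complexConj L) 3).automorphicQuotient) [(quasiSplit (↥(maximalRealSubfield L)) L (IsCMField.complexConj L) 3).IsAutomorphicMeasure μ] (ξ : OneDimAutRepH L) (μω : HeckeCharacter L)
  (hμu : μω.IsUnitary)
  -- the space of sections: level-free `(χ₁, χ₂)`-pair sections of the `φ_ξ`-block, continuous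
  (V : Submodule ℂ ((quasiSplit (↥(maximalRealSubfield L)) L (IsCMField.complexConj L) 3).Adelic → ℂ))
  (hVχ : ∀ φ ∈ V, φ ∈ chiSectionSpacePair (ξ.bcη⁻¹ * ξ.bcψ⁻¹ * μω) ξ.ψ (⊥ : Subgroup (quasiSplit (↥(maximalRealSubfield L)) L (IsCMField.complexConj L) 3).Adelic) ((1 : ↥(⊥ : Subgroup (quasiSplit (↥(maximalRealSubfield L)) L (IsCMField.complexConj L) 3).Adelic) →* ℂ) : ↥(⊥ : Subgroup (quasiSplit (↥(maximalRealSubfield L)) L (IsCMField.complexConj L) 3).Adelic) → ℂ))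
  (hVc : ∀ φ ∈ V, Continuous φ)
  -- ESTATE T's data on `V` (D1's clauses): continuation, pole set, pole function, residue class
  (Ec : ↥V → ℂ → (quasiSplit (↥(maximalRealSubfield L)) L (IsCMField.complexConj L) 3).Adelic → ℂ) (Sp : ↥V → Finset ℂ)
  (hSp : ∀ (φ : ↥V), ∀ t ∈ Sp φ, t.im = 0 ∧ 1 < t.re ∧ t.re ≤ 2)
  (hol : ∀ (φ : ↥V) (y : (quasiSplit (↥(maximalRealSubfield L)) L (IsCMField.complexConj L) 3).Adelic), DifferentiableOn ℂ (fun z => Ec φ z y) ({z : ℂ | 1 < z.re} \ (↑(Sp φ) : Set ℂ)))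
  (hEc : ∀ (φ : ↥V) (z : ℂ), 2 < z.re → Ec φ z = eisensteinSeriesU (flatSectionU (φ : (quasiSplit (↥(maximalRealSubfield L)) L (IsCMField.complexConj L) 3).Adelic → ℂ) z))
  (Fp : ↥V → (quasiSplit (↥(maximalRealSubfield L)) L (IsCMField.complexConj L) 3).Adelic → ℂ → ℂ) (hF : ∀ (φ : ↥V) (y : (quasiSplit (↥(maximalRealSubfield L)) L (IsCMField.complexConj L) 3).Adelic), AnalyticAt ℂ (Fp φ y) ((3 : ℂ) / 2))
  (hFE : ∀ (φ : ↥V) (y : (quasiSplit (↥(maximalRealSubfield L)) L (IsCMField.complexConj L) 3).Adelic), Fp φ y =ᶠ[𝓝[≠] ((3 : ℂ) / 2)] fun z => (z - (3 : ℂ) / 2) * Ec φ z y)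
  (Rf : ↥V → (quasiSplit (↥(maximalRealSubfield L)) L (IsCMField.complexConj L) 3).L2 μ)
  (hae : ∀ φ : ↥V, ((Rf φ : (quasiSplit (↥(maximalRealSubfield L)) L (IsCMField.complexConj L) 3).L2 μ) : (quasiSplit (↥(maximalRealSubfield L)) L (IsCMField.complexConj L) 3).automorphicQuotient → ℂ) =ᵐ[μ] fun x => Fp φ (Quotient.out (x : ((quasiSplit (↥(maximalRealSubfield L)) L (IsCMField.complexConj L) 3).Adelic ⧸ (quasiSplit (↥(maximalRealSubfield L)) L (IsCMField.complexConj L) 3).quotientSubgroup)))⁻¹ ((3 : ℂ) / 2))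

include hμu hVχ hVc hSp hol hEc hF hFE hae

/-- **`Res (Σᵢ aᵢ φᵢ) = Σᵢ aᵢ Res φᵢ`** for sections `φᵢ ∈ V` — ★ LIN `res_class_finset_sum` read on the data families over `V` (the class of the combination is `Rf` of the
combination, which lies in `V`). [cite: MoeglinWaldspurger1995, II.1.5, IV.1.11, V.3.13] -/
theorem resClass_finset_sum {ι : Type*} (s : Finset ι) (a : ι → ℂ) (φ : ι → ↥V) :
    Rf (∑ i ∈ s, a i • φ i) = ∑ i ∈ s, a i • Rf (φ i) := by
  have hsum : ((∑ i ∈ s, a i • φ i : ↥V) : (quasiSplit (↥(maximalRealSubfield L)) L (IsCMField.complexConj L) 3).Adelic → ℂ) = ∑ i ∈ s, a i • (φ i : (quasiSplit (↥(maximalRealSubfield L)) L (IsCMField.complexConj L) 3).Adelic → ℂ) := by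
    rw [AddSubmonoidClass.coe_finsetSum]
    exact Finset.sum_congr rfl fun i _ => Submodule.coe_smul (a i) (φ i)
  exact res_class_finset_sum L μ ξ μω hμu s a (fun i => (φ i : (quasiSplit (↥(maximalRealSubfield L)) L (IsCMField.complexConj L) 3).Adelic → ℂ)) (fun i _ => hVχ _ (φ i).2) (fun i _ => hVc _ (φ i).2) hsum
    (Ec (∑ i ∈ s, a i • φ i)) (Sp (∑ i ∈ s, a i • φ i)) (hSp _) (hol _) (hEc _) (Fp (∑ i ∈ s, a i • φ i)) (hF _) (hFE _) (hae _)
    (fun i => Ec (φ i)) (fun i => Sp (φ i)) (fun i _ => hSp (φ i)) (fun i _ => hol (φ i)) (fun i _ => hEc (φ i)) (fun i => Fp (φ i)) (fun i _ => hF (φ i))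
    (fun i _ => hFE (φ i)) (fun i => Rf (φ i)) (fun i _ => hae (φ i))

/-- **`Res` IS A LINEAR MAP `V →ₗ[ℂ] L²`** agreeing with the residue-class family `Rf`. [cite: MoeglinWaldspurger1995, II.1.5, IV.1.11, V.3.13] -/
theorem exists_linearMap_resClass : ∃ R : ↥V →ₗ[ℂ] (quasiSplit (↥(maximalRealSubfield L)) L (IsCMField.complexConj L) 3).L2 μ, ∀ φ : ↥V, R φ = Rf φ := by
  have hadd : ∀ φ ψ : ↥V, Rf (φ + ψ) = Rf φ + Rf ψ := fun φ ψ => by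
    have h := resClass_finset_sum L μ ξ μω hμu V hVχ hVc Ec Sp hSp hol hEc Fp hF hFE Rf hae (Finset.univ : Finset Bool) (fun _ => (1 : ℂ)) (fun b => cond b φ ψ)
    simpa only [Fintype.sum_bool, cond_true, cond_false, one_smul] using h
  have hsmul : ∀ (a : ℂ) (φ : ↥V), Rf (a • φ) = a • Rf φ := fun a φ => by
    have h := resClass_finset_sum L μ ξ μω hμu V hVχ hVc Ec Sp hSp hol hEc Fp hF hFE Rf hae (Finset.univ : Finset Unit) (fun _ => a) (fun _ => φ)
    simpa only [Finset.univ_unique, Finset.sum_singleton] using h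
  exact ⟨{ toFun := Rf, map_add' := hadd, map_smul' := hsmul }, fun _ => rfl⟩

/-! ## §3 Finite-adelic equivariance: `R(ι_f g)(Res φ) = Res(g·φ)` -/

/-- **`R(ι_f g)(Res φ) = Res φ′` WHEN `φ′ = g·φ` POINTWISE**, `(g·φ)(x) = φ(x ι_f g)·c_g(x)^{3∕2}`, for `φ, φ′ ∈ V` with the pieces `ψ_r = 𝟙[c_g = r]·φ(· ι_f g)` in `V`
(`hVpiece`): ★ FILE A re-expands `flat(φ, z)(x ι_f g) = Σ_r r^z flat(ψ_r, z)(x)` over the finite value set of the cocycle (★ `exists_finset_range_heightCocycle`), ★ FILE B turns it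
into `R(ι_f g)(Res φ) = Σ_r r^{3∕2} Res ψ_r`, and `φ′ = Σ_r r^{3∕2} ψ_r` (§1) with §2 gives `Res φ′ = Σ_r r^{3∕2} Res ψ_r`. [cite: MoeglinWaldspurger1995, II.1.5, IV.1.11, V.3.13]
[cite: Garrett2018, §2.2] -/
theorem rightRegular_resClass_eq_of_heightTranslate (g : ↥(finAdelic (↥(maximalRealSubfield L)) L (IsCMField.complexConj L) 3 ((StdForm.antidiagonal 3).over L))) (φ φ' : ↥V)
    (hVpiece : ∀ r : ℝ≥0, ({x : (quasiSplit (↥(maximalRealSubfield L)) L (IsCMField.complexConj L) 3).Adelic | borelHeight (x * finAdelicToAdelic (↥(maximalRealSubfield L)) L (IsCMField.complexConj L) 3 ((StdForm.antidiagonal 3).over L) g) / borelHeight x = r}.indicator fun y => (φ : (quasiSplit (↥(maximalRealSubfield L)) L (IsCMField.complexConj L) 3).Adelic → ℂ) (y * finAdelicToAdelic (↥(maximalRealSubfield L)) L (IsCMField.complexConj L) 3 ((StdForm.antidiagonal 3).over L) g)) ∈ V)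
    (hφ' : ∀ x : (quasiSplit (↥(maximalRealSubfield L)) L (IsCMField.complexConj L) 3).Adelic, (φ' : (quasiSplit (↥(maximalRealSubfield L)) L (IsCMField.complexConj L) 3).Adelic → ℂ) x =
      (φ : (quasiSplit (↥(maximalRealSubfield L)) L (IsCMField.complexConj L) 3).Adelic → ℂ) (x * finAdelicToAdelic (↥(maximalRealSubfield L)) L (IsCMField.complexConj L) 3 ((StdForm.antidiagonal 3).over L) g) * (((borelHeight (x * finAdelicToAdelic (↥(maximalRealSubfield L)) L (IsCMField.complexConj L) 3 ((StdForm.antidiagonal 3).over L) g) / borelHeight x : ℝ≥0) : ℝ) : ℂ) ^ ((3 : ℂ) / 2)) :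
    ((quasiSplit (↥(maximalRealSubfield L)) L (IsCMField.complexConj L) 3).rightRegular μ) (finAdelicToAdelic (↥(maximalRealSubfield L)) L (IsCMField.complexConj L) 3 ((StdForm.antidiagonal 3).over L) g) (Rf φ) = Rf φ' := by
  obtain ⟨s, hs, hpos⟩ := exists_finset_range_heightCocycle L g
  -- the pieces as members of `V`
  let ψV : ℝ≥0 → ↥V := fun r => ⟨({x : (quasiSplit (↥(maximalRealSubfield L)) L (IsCMField.complexConj L) 3).Adelic | borelHeight (x * finAdelicToAdelic (↥(maximalRealSubfield L)) L (IsCMField.complexConj L) 3 ((StdForm.antidiagonal 3).over L) g) / borelHeight x = r}.indicator fun y => (φ : (quasiSplit (↥(maximalRealSubfield L)) L (IsCMField.complexConj L) 3).Adelic → ℂ) (y * finAdelicToAdelic (↥(maximalRealSubfield L)) L (IsCMField.complexConj L) 3 ((StdForm.antidiagonal 3).over L) g)), hVpiece r⟩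
  have hψV : ∀ r : ℝ≥0, (ψV r : (quasiSplit (↥(maximalRealSubfield L)) L (IsCMField.complexConj L) 3).Adelic → ℂ) = ({x : (quasiSplit (↥(maximalRealSubfield L)) L (IsCMField.complexConj L) 3).Adelic | borelHeight (x * finAdelicToAdelic (↥(maximalRealSubfield L)) L (IsCMField.complexConj L) 3 ((StdForm.antidiagonal 3).over L) g) / borelHeight x = r}.indicator fun y => (φ : (quasiSplit (↥(maximalRealSubfield L)) L (IsCMField.complexConj L) 3).Adelic → ℂ) (y * finAdelicToAdelic (↥(maximalRealSubfield L)) L (IsCMField.complexConj L) 3 ((StdForm.antidiagonal 3).over L) g)) := fun r => rfl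
  -- ★ FILE B along ★ FILE A's re-expansion
  have hdec : ∀ (z : ℂ) (x : (quasiSplit (↥(maximalRealSubfield L)) L (IsCMField.complexConj L) 3).Adelic), flatSectionU (φ : (quasiSplit (↥(maximalRealSubfield L)) L (IsCMField.complexConj L) 3).Adelic → ℂ) z (x * finAdelicToAdelic (↥(maximalRealSubfield L)) L (IsCMField.complexConj L) 3 ((StdForm.antidiagonal 3).over L) g) = ∑ r ∈ s, (((r : ℝ) : ℂ) ^ z) * flatSectionU (ψV r : (quasiSplit (↥(maximalRealSubfield L)) L (IsCMField.complexConj L) 3).Adelic → ℂ) z x :=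
    fun z x => by simp only [hψV]; exact flatSectionU_mul_finAdelicToAdelic_eq_sum L g hs (φ : (quasiSplit (↥(maximalRealSubfield L)) L (IsCMField.complexConj L) 3).Adelic → ℂ) z x
  have hB := rightRegular_apply_eq_sum_of_flatReexpansion L μ ξ μω hμu (hVχ _ φ.2) (Ec φ) (Sp φ) (hSp φ) (hol φ) (hEc φ) (Fp φ) (hF φ) (hFE φ) (hae φ)
    (finAdelicToAdelic (↥(maximalRealSubfield L)) L (IsCMField.complexConj L) 3 ((StdForm.antidiagonal 3).over L) g) s (fun r => r) hpos (fun r => (ψV r : (quasiSplit (↥(maximalRealSubfield L)) L (IsCMField.complexConj L) 3).Adelic → ℂ)) (fun r _ => hVχ _ (ψV r).2) (fun r _ => hVc _ (ψV r).2)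
    (fun r => Ec (ψV r)) (fun r => Sp (ψV r)) (fun r _ => hSp (ψV r)) (fun r _ => hol (ψV r)) (fun r _ => hEc (ψV r)) (fun r => Fp (ψV r)) (fun r _ => hF (ψV r))
    (fun r _ => hFE (ψV r)) (fun r => Rf (ψV r)) (fun r _ => hae (ψV r)) hdec
  -- `φ′ = Σ_r r^{3/2} • ψ_r` in `V`
  have hφ'sum : φ' = ∑ r ∈ s, (((r : ℝ) : ℂ) ^ ((3 : ℂ) / 2)) • ψV r := by
    apply Subtype.ext
    rw [AddSubmonoidClass.coe_finsetSum]
    funext x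
    rw [hφ' x, Finset.sum_congr rfl fun r _ => Submodule.coe_smul ((((r : ℝ≥0) : ℝ) : ℂ) ^ ((3 : ℂ) / 2)) (ψV r)]
    simp only [hψV]
    exact (sum_cpow_smul_piece_apply L g hs (φ : (quasiSplit (↥(maximalRealSubfield L)) L (IsCMField.complexConj L) 3).Adelic → ℂ) ((3 : ℂ) / 2) x).symm
  rw [hB, hφ'sum, resClass_finset_sum L μ ξ μω hμu V hVχ hVc Ec Sp hSp hol hEc Fp hF hFE Rf hae]

/-! ## §4 The package: `Res : V →ₗ L²` linear and finite-adelically equivariant -/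

/-- **THE BUNDLED RESIDUE MAP**: on a section space `V` carrying ESTATE T's data and closed under the pieces of finite-adelic translates (`hVpiece`), there is a linear
`R : V →ₗ[ℂ] L²` with `R = Rf` and `R(ι_f g)(R φ) = R φ′` whenever `φ′ = g·φ` pointwise (`z₀ = 3∕2` action). [cite: MoeglinWaldspurger1995, II.1.5, IV.1.11, V.3.13]
[cite: Langlands1976, §6–§7] -/
theorem exists_linearMap_resClass_equivariant
    (hVpiece : ∀ φ ∈ V, ∀ (g : ↥(finAdelic (↥(maximalRealSubfield L)) L (IsCMField.complexConj L) 3 ((StdForm.antidiagonal 3).over L))) (r : ℝ≥0), ({x : (quasiSplit (↥(maximalRealSubfield L)) L (IsCMField.complexConj L) 3).Adelic | borelHeight (x * finAdelicToAdelic (↥(maximalRealSubfield L)) L (IsCMField.complexConj L) 3 ((StdForm.antidiagonal 3).over L) g) / borelHeight x = r}.indicator fun y => φ (y * finAdelicToAdelic (↥(maximalRealSubfield L)) L (IsCMField.complexConj L) 3 ((StdForm.antidiagonal 3).over L) g)) ∈ V) :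
    ∃ R : ↥V →ₗ[ℂ] (quasiSplit (↥(maximalRealSubfield L)) L (IsCMField.complexConj L) 3).L2 μ, (∀ φ : ↥V, R φ = Rf φ) ∧
      ∀ (g : ↥(finAdelic (↥(maximalRealSubfield L)) L (IsCMField.complexConj L) 3 ((StdForm.antidiagonal 3).over L))) (φ φ' : ↥V), (∀ x : (quasiSplit (↥(maximalRealSubfield L)) L (IsCMField.complexConj L) 3).Adelic, (φ' : (quasiSplit (↥(maximalRealSubfield L)) L (IsCMField.complexConj L) 3).Adelic → ℂ) x =
          (φ : (quasiSplit (↥(maximalRealSubfield L)) L (IsCMField.complexConj L) 3).Adelic → ℂ) (x * finAdelicToAdelic (↥(maximalRealSubfield L)) L (IsCMField.complexConj L) 3 ((StdForm.antidiagonal 3).over L) g) * (((borelHeight (x * finAdelicToAdelic (↥(maximalRealSubfield L)) L (IsCMField.complexConj L) 3 ((StdForm.antidiagonal 3).over L) g) / borelHeight x : ℝ≥0) : ℝ) : ℂ) ^ ((3 : ℂ) / 2)) →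
        ((quasiSplit (↥(maximalRealSubfield L)) L (IsCMField.complexConj L) 3).rightRegular μ) (finAdelicToAdelic (↥(maximalRealSubfield L)) L (IsCMField.complexConj L) 3 ((StdForm.antidiagonal 3).over L) g) (R φ) = R φ' := by
  obtain ⟨R, hR⟩ := exists_linearMap_resClass L μ ξ μω hμu V hVχ hVc Ec Sp hSp hol hEc Fp hF hFE Rf hae
  refine ⟨R, hR, fun g φ φ' hφ' => ?_⟩
  rw [hR, hR]
  exact rightRegular_resClass_eq_of_heightTranslate L μ ξ μω hμu V hVχ hVc Ec Sp hSp hol hEc Fp hF hFE Rf hae g φ φ' (hVpiece _ φ.2 g) hφ'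

/-- **… FOR A `Representation` OF `G(𝔸_f)` ON `V` WHOSE FORMULA IS THE `z₀ = 3∕2` ACTION** (`hρ`; SEC-DICT's Defs leaf discharges it by `rfl`): `R(ι_f g)(Rf φ) = Rf (ρ g φ)`.
[cite: MoeglinWaldspurger1995, I.2.17, II.1.5, IV.1.11] -/
theorem rightRegular_resClass_eq_rep
    (hVpiece : ∀ φ ∈ V, ∀ (g : ↥(finAdelic (↥(maximalRealSubfield L)) L (IsCMField.complexConj L) 3 ((StdForm.antidiagonal 3).over L))) (r : ℝ≥0), ({x : (quasiSplit (↥(maximalRealSubfield L)) L (IsCMField.complexConj L) 3).Adelic | borelHeight (x * finAdelicToAdelic (↥(maximalRealSubfield L)) L (IsCMField.complexConj L) 3 ((StdForm.antidiagonal 3).over L) g) / borelHeight x = r}.indicator fun y => φ (y * finAdelicToAdelic (↥(maximalRealSubfield L)) L (IsCMField.complexConj L) 3 ((StdForm.antidiagonal 3).over L) g)) ∈ V)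
    (ρ : Representation ℂ ↥(finAdelic (↥(maximalRealSubfield L)) L (IsCMField.complexConj L) 3 ((StdForm.antidiagonal 3).over L)) ↥V)
    (hρ : ∀ (g : ↥(finAdelic (↥(maximalRealSubfield L)) L (IsCMField.complexConj L) 3 ((StdForm.antidiagonal 3).over L))) (φ : ↥V) (x : (quasiSplit (↥(maximalRealSubfield L)) L (IsCMField.complexConj L) 3).Adelic), ((ρ g φ : ↥V) : (quasiSplit (↥(maximalRealSubfield L)) L (IsCMField.complexConj L) 3).Adelic → ℂ) x =
      (φ : (quasiSplit (↥(maximalRealSubfield L)) L (IsCMField.complexConj L) 3).Adelic → ℂ) (x * finAdelicToAdelic (↥(maximalRealSubfield L)) L (IsCMField.complexConj L) 3 ((StdForm.antidiagonal 3).over L) g) * (((borelHeight (x * finAdelicToAdelic (↥(maximalRealSubfield L)) L (IsCMField.complexConj L) 3 ((StdForm.antidiagonal 3).over L) g) / borelHeight x : ℝ≥0) : ℝ) : ℂ) ^ ((3 : ℂ) / 2))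
    (g : ↥(finAdelic (↥(maximalRealSubfield L)) L (IsCMField.complexConj L) 3 ((StdForm.antidiagonal 3).over L))) (φ : ↥V) :
    ((quasiSplit (↥(maximalRealSubfield L)) L (IsCMField.complexConj L) 3).rightRegular μ) (finAdelicToAdelic (↥(maximalRealSubfield L)) L (IsCMField.complexConj L) 3 ((StdForm.antidiagonal 3).over L) g) (Rf φ) = Rf (ρ g φ) :=
  rightRegular_resClass_eq_of_heightTranslate L μ ξ μω hμu V hVχ hVc Ec Sp hSp hol hEc Fp hF hFE Rf hae g φ (ρ g φ) (hVpiece _ φ.2 g) (hρ g φ)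

/-- **THE `(R, hR)` BINDERS BEFORE THE FRAME**: `∃ R : V →ₗ[ℂ] L², R = Rf ∧ ∀ g φ, R(ι_f g)(R φ) = R (ρ g φ)` — the residue map is an intertwining operator from the `z₀ = 3∕2`
section representation of `G(𝔸_f)` to the right-regular representation on `L²`; composing `ρ` and `R(ι_f ·)` with the frame `G_v → G(𝔸_f)` (`inclPlace v ∘ (localPiEquiv v)⁻¹ ∘
cmDatumLocalCongr`) gives ★ `dictionary_D2_of_localIntertwiner`'s `hR` at the place `v`. [cite: MoeglinWaldspurger1995, II.1.5–II.1.7, IV.1.9–IV.1.11] [cite: Langlands1976, §6–§7] -/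
theorem exists_linearMap_resClass_equivariant_rep
    (hVpiece : ∀ φ ∈ V, ∀ (g : ↥(finAdelic (↥(maximalRealSubfield L)) L (IsCMField.complexConj L) 3 ((StdForm.antidiagonal 3).over L))) (r : ℝ≥0), ({x : (quasiSplit (↥(maximalRealSubfield L)) L (IsCMField.complexConj L) 3).Adelic | borelHeight (x * finAdelicToAdelic (↥(maximalRealSubfield L)) L (IsCMField.complexConj L) 3 ((StdForm.antidiagonal 3).over L) g) / borelHeight x = r}.indicator fun y => φ (y * finAdelicToAdelic (↥(maximalRealSubfield L)) L (IsCMField.complexConj L) 3 ((StdForm.antidiagonal 3).over L) g)) ∈ V)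
    (ρ : Representation ℂ ↥(finAdelic (↥(maximalRealSubfield L)) L (IsCMField.complexConj L) 3 ((StdForm.antidiagonal 3).over L)) ↥V)
    (hρ : ∀ (g : ↥(finAdelic (↥(maximalRealSubfield L)) L (IsCMField.complexConj L) 3 ((StdForm.antidiagonal 3).over L))) (φ : ↥V) (x : (quasiSplit (↥(maximalRealSubfield L)) L (IsCMField.complexConj L) 3).Adelic), ((ρ g φ : ↥V) : (quasiSplit (↥(maximalRealSubfield L)) L (IsCMField.complexConj L) 3).Adelic → ℂ) x =
      (φ : (quasiSplit (↥(maximalRealSubfield L)) L (IsCMField.complexConj L) 3).Adelic → ℂ) (x * finAdelicToAdelic (↥(maximalRealSubfield L)) L (IsCMField.complexConj L) 3 ((StdForm.antidiagonal 3).over L) g) * (((borelHeight (x * finAdelicToAdelic (↥(maximalRealSubfield L)) L (IsCMField.complexConj L) 3 ((StdForm.antidiagonal 3).over L) g) / borelHeight x : ℝ≥0) : ℝ) : ℂ) ^ ((3 : ℂ) / 2)) :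
    ∃ R : ↥V →ₗ[ℂ] (quasiSplit (↥(maximalRealSubfield L)) L (IsCMField.complexConj L) 3).L2 μ, (∀ φ : ↥V, R φ = Rf φ) ∧ ∀ (g : ↥(finAdelic (↥(maximalRealSubfield L)) L (IsCMField.complexConj L) 3 ((StdForm.antidiagonal 3).over L))) (φ : ↥V), ((quasiSplit (↥(maximalRealSubfield L)) L (IsCMField.complexConj L) 3).rightRegular μ) (finAdelicToAdelic (↥(maximalRealSubfield L)) L (IsCMField.complexConj L) 3 ((StdForm.antidiagonal 3).over L) g) (R φ) = R (ρ g φ) := by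
  obtain ⟨R, hR, hReq⟩ := exists_linearMap_resClass_equivariant L μ ξ μω hμu V hVχ hVc Ec Sp hSp hol hEc Fp hF hFE Rf hae hVpiece
  exact ⟨R, hR, fun g φ => hReq g φ (ρ g φ) (hρ g φ)⟩

/-! ## §5 `Res φ` is a smooth vector of `R ∘ ι_f` -/

/-- **`Res φ ∈ (L²)^∞`** (the smooth part of `R ∘ ι_f`, the W11 ambient of ★ p865275): a section `φ ∈ V` right-invariant under a τ-level `U₀` (`hU₀ : IsTauLevel`, `hφU`) has its
residue class fixed by `ι_f(U₀)` — §3 at `g = u ∈ U₀`, where the cocycle is `≡ 1` (★ `borelHeight_mul_finAdelicToAdelic_of_mem_integralLevel`, `U₀ ≤ G(𝒪̂)_f`) so `u·φ = φ` — and `U₀`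
is open (★ `Representation.isSmoothVector_of_le`). [cite: MoeglinWaldspurger1995, I.2.17, II.1.5] [cite: BernsteinZelevinsky1976, §2.1] -/
theorem resClass_mem_smoothPart
    (hVpiece : ∀ φ ∈ V, ∀ (g : ↥(finAdelic (↥(maximalRealSubfield L)) L (IsCMField.complexConj L) 3 ((StdForm.antidiagonal 3).over L))) (r : ℝ≥0), ({x : (quasiSplit (↥(maximalRealSubfield L)) L (IsCMField.complexConj L) 3).Adelic | borelHeight (x * finAdelicToAdelic (↥(maximalRealSubfield L)) L (IsCMField.complexConj L) 3 ((StdForm.antidiagonal 3).over L) g) / borelHeight x = r}.indicator fun y => φ (y * finAdelicToAdelic (↥(maximalRealSubfield L)) L (IsCMField.complexConj L) 3 ((StdForm.antidiagonal 3).over L) g)) ∈ V)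
    (φ : ↥V) {U₀ : Subgroup ↥(finAdelic (↥(maximalRealSubfield L)) L (IsCMField.complexConj L) 3 ((StdForm.antidiagonal 3).over L))} (hU₀ : IsTauLevel L U₀) (hφU : ∀ u ∈ U₀, ∀ x : (quasiSplit (↥(maximalRealSubfield L)) L (IsCMField.complexConj L) 3).Adelic, (φ : (quasiSplit (↥(maximalRealSubfield L)) L (IsCMField.complexConj L) 3).Adelic → ℂ) (x * finAdelicToAdelic (↥(maximalRealSubfield L)) L (IsCMField.complexConj L) 3 ((StdForm.antidiagonal 3).over L) u) = (φ : (quasiSplit (↥(maximalRealSubfield L)) L (IsCMField.complexConj L) 3).Adelic → ℂ) x) :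
    Rf φ ∈ Representation.smoothPart (((quasiSplit (↥(maximalRealSubfield L)) L (IsCMField.complexConj L) 3).rightRegular μ).toRepresentation.comp (finAdelicToAdelic (↥(maximalRealSubfield L)) L (IsCMField.complexConj L) 3 ((StdForm.antidiagonal 3).over L))) := by
  rw [Representation.mem_smoothPart]
  refine Representation.isSmoothVector_of_le _ hU₀.1 fun u hu => ?_
  rw [Representation.mem_stabilizerSubgroup]
  change ((quasiSplit (↥(maximalRealSubfield L)) L (IsCMField.complexConj L) 3).rightRegular μ) (finAdelicToAdelic (↥(maximalRealSubfield L)) L (IsCMField.complexConj L) 3 ((StdForm.antidiagonal 3).over L) u) (Rf φ) = Rf φ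
  refine rightRegular_resClass_eq_of_heightTranslate L μ ξ μω hμu V hVχ hVc Ec Sp hSp hol hEc Fp hF hFE Rf hae u φ φ (hVpiece _ φ.2 u) fun x => ?_
  rw [borelHeight_mul_finAdelicToAdelic_of_mem_integralLevel (hU₀.2.2 hu), div_self (borelHeight_pos x).ne', NNReal.coe_one, Complex.ofReal_one, Complex.one_cpow, mul_one,
    hφU u hu x]

/-! ## §6 The `(R, hR)` binders of ★ `dictionary_D2_of_localIntertwiner` along a frame `G_v →* G(𝔸_f)` -/

/-- **THE RESIDUE MAP INTO `(L²)^∞`, `G_v`-EQUIVARIANT ALONG ANY FRAME.**  On a section space `V` carrying ESTATE T's data, closed under pieces (`hVpiece`), every member at some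
τ-level (`hVlev`), with the `z₀ = 3∕2` action as a `Representation` `ρ` of `G(𝔸_f)` (`hρ`), and for any group homomorphism `fr : G_v →* G(𝔸_f)`: there is `R : V →ₗ[ℂ] (L²)^∞` with
`R = Rf` on the nose and `R ((ρ ∘ fr) g w) = ((L²)^∞ ∘ fr) g (R w)` — the `(R, hR)` binders of ★ `dictionary_D2_of_localIntertwiner` ∕ ★ `dictionary_D2_of_tensorClause` with
`ρ := ρ ∘ fr`, `σ := (L²)^∞ ∘ fr` (the W11 ambient at `fr := inclPlace v ∘ (localPiEquiv v)⁻¹ ∘ cmDatumLocalCongr`, up to the definitional re-association of `∘`).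
[cite: MoeglinWaldspurger1995, II.1.5–II.1.7, IV.1.9–IV.1.11] [cite: Langlands1976, §6–§7] [cite: BorelJacquet1979, §4.6] -/
theorem exists_linearMap_resClass_frame
    (hVpiece : ∀ φ ∈ V, ∀ (g : ↥(finAdelic (↥(maximalRealSubfield L)) L (IsCMField.complexConj L) 3 ((StdForm.antidiagonal 3).over L))) (r : ℝ≥0), ({x : (quasiSplit (↥(maximalRealSubfield L)) L (IsCMField.complexConj L) 3).Adelic | borelHeight (x * finAdelicToAdelic (↥(maximalRealSubfield L)) L (IsCMField.complexConj L) 3 ((StdForm.antidiagonal 3).over L) g) / borelHeight x = r}.indicator fun y => φ (y * finAdelicToAdelic (↥(maximalRealSubfield L)) L (IsCMField.complexConj L) 3 ((StdForm.antidiagonal 3).over L) g)) ∈ V)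
    (hVlev : ∀ φ : ↥V, ∃ U₀ : Subgroup ↥(finAdelic (↥(maximalRealSubfield L)) L (IsCMField.complexConj L) 3 ((StdForm.antidiagonal 3).over L)), IsTauLevel L U₀ ∧ ∀ u ∈ U₀, ∀ x : (quasiSplit (↥(maximalRealSubfield L)) L (IsCMField.complexConj L) 3).Adelic, (φ : (quasiSplit (↥(maximalRealSubfield L)) L (IsCMField.complexConj L) 3).Adelic → ℂ) (x * finAdelicToAdelic (↥(maximalRealSubfield L)) L (IsCMField.complexConj L) 3 ((StdForm.antidiagonal 3).over L) u) = (φ : (quasiSplit (↥(maximalRealSubfield L)) L (IsCMField.complexConj L) 3).Adelic → ℂ) x)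
    (ρ : Representation ℂ ↥(finAdelic (↥(maximalRealSubfield L)) L (IsCMField.complexConj L) 3 ((StdForm.antidiagonal 3).over L)) ↥V)
    (hρ : ∀ (g : ↥(finAdelic (↥(maximalRealSubfield L)) L (IsCMField.complexConj L) 3 ((StdForm.antidiagonal 3).over L))) (φ : ↥V) (x : (quasiSplit (↥(maximalRealSubfield L)) L (IsCMField.complexConj L) 3).Adelic), ((ρ g φ : ↥V) : (quasiSplit (↥(maximalRealSubfield L)) L (IsCMField.complexConj L) 3).Adelic → ℂ) x =
      (φ : (quasiSplit (↥(maximalRealSubfield L)) L (IsCMField.complexConj L) 3).Adelic → ℂ) (x * finAdelicToAdelic (↥(maximalRealSubfield L)) L (IsCMField.complexConj L) 3 ((StdForm.antidiagonal 3).over L) g) * (((borelHeight (x * finAdelicToAdelic (↥(maximalRealSubfield L)) L (IsCMField.complexConj L) 3 ((StdForm.antidiagonal 3).over L) g) / borelHeight x : ℝ≥0) : ℝ) : ℂ) ^ ((3 : ℂ) / 2))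
    {Gv : Type*} [Group Gv] (fr : Gv →* ↥(finAdelic (↥(maximalRealSubfield L)) L (IsCMField.complexConj L) 3 ((StdForm.antidiagonal 3).over L))) :
    ∃ R : ↥V →ₗ[ℂ] ↥(Representation.smoothPart (((quasiSplit (↥(maximalRealSubfield L)) L (IsCMField.complexConj L) 3).rightRegular μ).toRepresentation.comp (finAdelicToAdelic (↥(maximalRealSubfield L)) L (IsCMField.complexConj L) 3 ((StdForm.antidiagonal 3).over L)))).toSubmodule,
      (∀ φ : ↥V, ((R φ : ↥(Representation.smoothPart (((quasiSplit (↥(maximalRealSubfield L)) L (IsCMField.complexConj L) 3).rightRegular μ).toRepresentation.comp (finAdelicToAdelic (↥(maximalRealSubfield L)) L (IsCMField.complexConj L) 3 ((StdForm.antidiagonal 3).over L)))).toSubmodule) : (quasiSplit (↥(maximalRealSubfield L)) L (IsCMField.complexConj L) 3).L2 μ) = Rf φ) ∧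
      ∀ (g : Gv) (w : ↥V), R ((ρ.comp fr) g w) = (((Representation.smoothPart (((quasiSplit (↥(maximalRealSubfield L)) L (IsCMField.complexConj L) 3).rightRegular μ).toRepresentation.comp (finAdelicToAdelic (↥(maximalRealSubfield L)) L (IsCMField.complexConj L) 3 ((StdForm.antidiagonal 3).over L)))).toRepresentation).comp fr) g (R w) := by
  obtain ⟨R₀, hR₀, hReq⟩ := exists_linearMap_resClass_equivariant_rep L μ ξ μω hμu V hVχ hVc Ec Sp hSp hol hEc Fp hF hFE Rf hae hVpiece ρ hρ
  have hmem : ∀ φ : ↥V, R₀ φ ∈ (Representation.smoothPart (((quasiSplit (↥(maximalRealSubfield L)) L (IsCMField.complexConj L) 3).rightRegular μ).toRepresentation.comp (finAdelicToAdelic (↥(maximalRealSubfield L)) L (IsCMField.complexConj L) 3 ((StdForm.antidiagonal 3).over L)))).toSubmodule := fun φ => by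
    obtain ⟨U₀, hU₀, hφU⟩ := hVlev φ
    rw [hR₀ φ]
    exact resClass_mem_smoothPart L μ ξ μω hμu V hVχ hVc Ec Sp hSp hol hEc Fp hF hFE Rf hae hVpiece φ hU₀ hφU
  refine ⟨LinearMap.codRestrict _ R₀ hmem, fun φ => by rw [LinearMap.codRestrict_apply, hR₀], fun g w => Subtype.ext ?_⟩
  change R₀ (ρ (fr g) w) = ((quasiSplit (↥(maximalRealSubfield L)) L (IsCMField.complexConj L) 3).rightRegular μ) (finAdelicToAdelic (↥(maximalRealSubfield L)) L (IsCMField.complexConj L) 3 ((StdForm.antidiagonal 3).over L) (fr g)) (R₀ w)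
  exact (hReq (fr g) w).symm

end Main

end Summit.HodgeConjecture.HodgeConjecture.R90.S8

end
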